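import Mathlib
import Literature.NumberTheory.Automorphic.AutomorphicKernelOperators

/-!
# Cusp means and the cuspidal subspace of `L²(SL₂(ℤ)\ℍ)`
(Iwaniec, *Spectral Methods of Automorphic Forms*, GSM 53, §1.2, PDF p. 12; §1.8, PDF pp. 20–21;
§3.1 (3.2), PDF pp. 40–41; §3.3 (3.15), PDF p. 44; §4.2, PDF p. 49)

Layer 20a of the `provefact` decomposition of `Literature.NumberTheory.Automorphic.sl2BallCount_asymp`
(`HyperbolicLatticeCount.lean`), third brick of the discrete part of the spectral theorem for
`L²(SL₂(ℤ)\ℍ)` behind `Iwaniec2002_thm_7_4_modular` (`ModularPretrace.lean`): the space of cusp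
forms `𝓒 ⊆ L²(𝒟)` as a closed subspace invariant under the invariant integral operators `T_k`
of `AutomorphicKernelOperators.lean`. Everything here is proved; nothing is vendored.

1. Horizontal translations `n(a) = (1 a; 0 1)` (`translSL`, `n(a) z = z + a`), measure
   preservation, the skew product `(a, z) ↦ (a, z + a)` and joint measurability of
   `(a, z) ↦ f(z + a)`.
2. **The cusp mean** `f₀(w) = ∫_0^1 f(w + ξ) dξ` (`cuspMean`; Iwaniec's zero-th Fourier
   coefficient (3.2) along the horocycle through `w`): translation invariant for
   `1`-periodic `f` (`cuspMean_vadd`).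
3. **`(L_k f)₀ = L_k(f₀)`** (`cuspMean_invariantOperator`; the computation of §4.2, p. 49,
   `g_𝔞(y) = ∫_ℍ k(z, w) f_𝔞(Im w) dμw`): `L_k` commutes with `n(a) ∈ SL₂(ℝ)` (§1.8) and Fubini,
   the joint integrability on `[0,1] × ℍ` coming from the compact support of the kernel
   (`integrable_kernel_mul_comp_vadd`).
4. Slices: `G₁ = G₂` a.e. gives `(G₁)₀ = (G₂)₀` a.e. (`cuspMean_congr_ae`); horocycle restrictions
   of a locally integrable `G` are integrable over a period for a.e. base point
   (`ae_intervalIntegrable_comp_vadd`); `G₀` is a.e.-strongly measurable.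
5. **The cuspidal subspace** `cuspSubmodule ⊆ Lp ℂ 2 (μ|𝒟)` of classes `g` with `(g^Γ)₀ = 0` a.e.,
   `g^Γ = autExt 𝒮ℒ 𝒟 g` the automorphic extension (the closure `𝓒̃(Γ\ℍ)` of Iwaniec's space of
   functions with vanishing zero-th Fourier term (3.15), §3.3, realised inside `L²(F)`).
6. **Closedness** (`isClosed_cuspSubmodule`): `∫_{B(z₀,D)} |(g^Γ)₀| dμ ≤ K_{z₀,D} ‖g‖_{L²(𝒟)}`
   (Tonelli, translation invariance of `μ`, Cauchy–Schwarz and the local `L²` bound of the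
   automorphic extension), so the cusp-mean map is continuous into `L¹_loc(ℍ)`.
7. **`T_k 𝓒 ⊆ 𝓒`** (`kernelCLM_mem_cuspSubmodule`, the Proposition of §4.2: "an invariant integral
   operator `L` maps the subspace `𝓒(Γ\ℍ)` into itself"): `(T_k g)^Γ = L_k g^Γ` a.e. and
   `(L_k g^Γ)₀ = L_k((g^Γ)₀) = 0`.

## References
* [Iwaniec2002] H. Iwaniec, *Spectral Methods of Automorphic Forms*, 2nd ed., GSM 53, AMS 2002,
  §1.2, PDF p. 12; §1.8, PDF pp. 20–21; §3.1 (3.2), PDF pp. 40–41; §3.3 (3.15) & Lemma 3.3, PDF p. 44;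
  §4.2, PDF p. 49.
-/

noncomputable section

open MeasureTheory Set Filter Real UpperHalfPlane
open scoped Topology MatrixGroups ComplexConjugate NNReal ENNReal Modular

namespace Literature.NumberTheory.Automorphic

/-! ## 1. Horizontal translations -/

/-- The unipotent translation `n(a) = (1 a; 0 1) ∈ SL₂(ℝ)` of the Iwasawa decomposition.
[cite: Iwaniec2002, §1.2, PDF p. 12] -/
def translSL (a : ℝ) : SL(2, ℝ) :=
  ⟨!![1, a; 0, 1], by rw [Matrix.det_fin_two_of]; ring⟩

/-- `n(a) z = z + a` ("the group `N` operates by translations"). [cite: Iwaniec2002, §1.2, PDF p. 12] -/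
theorem translSL_smul (a : ℝ) (z : ℍ) : translSL a • z = a +ᵥ z := by
  apply UpperHalfPlane.ext
  rw [coe_vadd, coe_specialLinearGroup_apply]
  simp [translSL, add_comm]

/-- The same through `GL₂(ℝ)`. [folklore] -/
theorem toGL_translSL_smul (a : ℝ) (z : ℍ) :
    (Matrix.SpecialLinearGroup.toGL (translSL a) : GL (Fin 2) ℝ) • z = a +ᵥ z := by
  rw [toGL_smul_eq, translSL_smul]

/-- Horizontal translations preserve the hyperbolic measure. [cite: Iwaniec2002, (1.8), PDF p. 10] -/
theorem measurePreserving_vadd (a : ℝ) :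
    MeasurePreserving (fun z : ℍ => a +ᵥ z) (volume : Measure ℍ) volume := by
  have h := measurePreserving_smul (Matrix.SpecialLinearGroup.toGL (translSL a) : GL (Fin 2) ℝ)
    (volume : Measure ℍ)
  simp_rw [toGL_translSL_smul] at h
  exact h

/-- `(a, z) ↦ z + a` is continuous. [folklore] -/
theorem continuous_vadd₂ : Continuous fun p : ℝ × ℍ => p.1 +ᵥ p.2 := by
  refine UpperHalfPlane.isEmbedding_coe.continuous_iff.mpr ?_
  have : (UpperHalfPlane.coe ∘ fun p : ℝ × ℍ => p.1 +ᵥ p.2) =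
      fun p : ℝ × ℍ => ((p.1 : ℂ) + (p.2 : ℂ)) := by
    funext p; simp [coe_vadd]
  rw [this]
  exact (Complex.continuous_ofReal.comp continuous_fst).add
    (UpperHalfPlane.continuous_coe.comp continuous_snd)

/-- `z ↦ z + a` is continuous. [folklore] -/
theorem continuous_vadd_const (a : ℝ) : Continuous fun z : ℍ => a +ᵥ z :=
  continuous_vadd₂.comp (continuous_const.prodMk continuous_id)

/-- The hyperbolic displacement of a horizontal translation: `ρ(z + a, z) ≤ |a| / Im z`. [folklore] -/
theorem dist_vadd_self_le (a : ℝ) (z : ℍ) : dist (a +ᵥ z) z ≤ |a| / z.im := by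
  have h := dist_le_dist_coe_div_sqrt (a +ᵥ z) z
  rw [vadd_im, coe_vadd] at h
  have e1 : dist ((a : ℂ) + (z : ℂ)) (z : ℂ) = |a| := by
    rw [Complex.dist_eq]; simp
  have e2 : Real.sqrt (z.im * z.im) = z.im := Real.sqrt_mul_self z.im_pos.le
  rwa [e1, e2] at h

/-- The skew translation `(a, z) ↦ (a, z + a)` preserves `μ_ℝ|_S ⊗ μ_ℍ` for any `S`. [folklore] -/
theorem measurePreserving_skew_vadd (μ : Measure ℝ) [SFinite μ] :
    MeasurePreserving (fun p : ℝ × ℍ => (p.1, p.1 +ᵥ p.2)) (μ.prod volume) (μ.prod volume) :=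
  (MeasurePreserving.id μ).skew_product (f := id) continuous_vadd₂.measurable
    (Eventually.of_forall fun a => (measurePreserving_vadd a).map_eq)

/-- Joint a.e.-strong measurability of `(a, z) ↦ f(z + a)`. [folklore] -/
theorem aestronglyMeasurable_comp_vadd {f : ℍ → ℂ} (hf : AEStronglyMeasurable f volume)
    (μ : Measure ℝ) [SFinite μ] :
    AEStronglyMeasurable (fun p : ℝ × ℍ => f (p.1 +ᵥ p.2)) (μ.prod volume) :=
  (hf.comp_snd (μ := μ)).comp_measurePreserving (measurePreserving_skew_vadd μ)

/-- Local integrability is preserved by horizontal translation. [folklore] -/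
theorem locallyIntegrable_comp_vadd {f : ℍ → ℂ} (hf : LocallyIntegrable f) (a : ℝ) :
    LocallyIntegrable fun z : ℍ => f (a +ᵥ z) := by
  rw [locallyIntegrable_iff] at hf ⊢
  intro K hK
  have hmp := measurePreserving_vadd a
  have hme : MeasurableEmbedding fun z : ℍ => a +ᵥ z :=
    (isometry_real_vadd a).isClosedEmbedding.measurableEmbedding
  have h1 := hf _ (hK.image (continuous_vadd_const a))
  rw [← hmp.integrableOn_comp_preimage hme] at h1
  have e : (fun z : ℍ => a +ᵥ z) ⁻¹' ((fun z : ℍ => a +ᵥ z) '' K) = K :=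
    hme.injective.preimage_image K
  rwa [e] at h1

/-! ## 2. The cusp mean (constant term along horocycles) -/

/-- **The cusp mean** of `f` at `w`: `f₀(w) = ∫_0^1 f(w + ξ) dξ`, the constant term of the
Fourier expansion of a `1`-periodic `f` along the horocycle `Im z = Im w`
(Iwaniec (3.2): `f_𝔞0(y) = ∫_0^1 f(σ_𝔞 z) dx`). [cite: Iwaniec2002, (3.2), PDF pp. 40–41] -/
def cuspMean (f : ℍ → ℂ) (w : ℍ) : ℂ := ∫ ξ in (0 : ℝ)..1, f (ξ +ᵥ w)

/-- Unfolding lemma. [folklore] -/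
theorem cuspMean_apply (f : ℍ → ℂ) (w : ℍ) : cuspMean f w = ∫ ξ in (0 : ℝ)..1, f (ξ +ᵥ w) := rfl

/-- For `f(z + 1) = f(z)` the horocycle restriction `ξ ↦ f(w + ξ)` is `1`-periodic. [folklore] -/
theorem periodic_comp_vadd {f : ℍ → ℂ} (hf : ∀ z : ℍ, f ((1 : ℝ) +ᵥ z) = f z) (w : ℍ) :
    Function.Periodic (fun ξ : ℝ => f (ξ +ᵥ w)) 1 := fun ξ => by
  simp only
  rw [add_comm, add_vadd, hf]

/-- **Translation invariance of the cusp mean**: `f₀(w + a) = f₀(w)` for `1`-periodic `f`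
(so `f₀` is a function of `Im w` alone). [cite: Iwaniec2002, (3.2), PDF pp. 40–41] -/
theorem cuspMean_vadd {f : ℍ → ℂ} (hf : ∀ z : ℍ, f ((1 : ℝ) +ᵥ z) = f z) (a : ℝ) (w : ℍ) :
    cuspMean f (a +ᵥ w) = cuspMean f w := by
  unfold cuspMean
  simp_rw [← add_vadd]
  rw [intervalIntegral.integral_comp_add_right (fun ξ : ℝ => f (ξ +ᵥ w)) a, zero_add]
  have h := (periodic_comp_vadd hf w).intervalIntegral_add_eq a 0
  rw [zero_add, add_comm] at h
  exact h

/-- The cusp mean is linear: scalars. [folklore] -/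
theorem cuspMean_const_mul (c : ℂ) (f : ℍ → ℂ) (w : ℍ) :
    cuspMean (fun z => c * f z) w = c * cuspMean f w := by
  unfold cuspMean; exact intervalIntegral.integral_const_mul c _

/-- The cusp mean of `0`. [folklore] -/
@[simp] theorem cuspMean_zero (w : ℍ) : cuspMean (fun _ => (0 : ℂ)) w = 0 := by
  simp [cuspMean]

/-- The cusp mean is additive where both horocycle restrictions are integrable. [folklore] -/
theorem cuspMean_add {f g : ℍ → ℂ} {w : ℍ} (hf : IntervalIntegrable (fun ξ : ℝ => f (ξ +ᵥ w)) volume 0 1)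
    (hg : IntervalIntegrable (fun ξ : ℝ => g (ξ +ᵥ w)) volume 0 1) :
    cuspMean (fun z => f z + g z) w = cuspMean f w + cuspMean g w := by
  unfold cuspMean; exact intervalIntegral.integral_add hf hg

/-! ## 3. The invariant integral operators commute with the cusp mean -/

variable {k : ℝ → ℝ}

/-- `(L_k f)(z + a) = L_k (f(· + a))(z)` (invariance of `L_k` under `n(a) ∈ SL₂(ℝ)`).
[cite: Iwaniec2002, §1.8, PDF pp. 20–21] -/
theorem invariantOperator_vadd (k : ℝ → ℝ) (f : ℍ → ℂ) (a : ℝ) (w : ℍ) :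
    invariantOperator k f (a +ᵥ w) = invariantOperator k (fun v => f (a +ᵥ v)) w := by
  rw [← translSL_smul, ← invariantOperator_comp_smul k f (translSL a) w]
  simp_rw [translSL_smul]

/-- The radius of the hyperbolic ball carrying a kernel vanishing on `[M, ∞)`. [folklore] -/
theorem kernel_support_radius {M : ℝ} (hM : ∀ u, M ≤ u → k u = 0) {z w : ℍ}
    (h : k (pointPairInv z w) ≠ 0) : dist z w ≤ 2 * Real.arsinh (Real.sqrt M) := by
  by_contra hlt
  exact h (kernel_eq_zero_of_dist hM (not_le.mp hlt))

/-- **Joint integrability** of `(ξ, v) ↦ k(u(w, v)) f(v + ξ)` on `[0,1] × ℍ` for a test kernel `k`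
and locally integrable `f`: the kernel confines `v` to the ball `B(w, R)`, whose translates by
`ξ ∈ [0, 1]` stay in the compact ball `B(w, R + 1/Im w)`. [folklore] -/
theorem integrable_kernel_mul_comp_vadd (hk : IsTestKernel k) {f : ℍ → ℂ} (hf : LocallyIntegrable f)
    (w : ℍ) :
    Integrable (fun p : ℝ × ℍ => (k (pointPairInv w p.2) : ℂ) * f (p.1 +ᵥ p.2))
      ((volume.restrict (Ioc (0 : ℝ) 1)).prod volume) := by
  obtain ⟨hkm, ⟨B, hB⟩, ⟨M, hM0, hM⟩⟩ := hk
  set μ : Measure ℝ := volume.restrict (Ioc (0 : ℝ) 1) with hμ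
  haveI : IsFiniteMeasure μ := by rw [hμ]; infer_instance
  set R : ℝ := 2 * Real.arsinh (Real.sqrt M) with hR
  set C : Set ℍ := Metric.closedBall w (R + 1 / w.im) with hC
  have hCc : IsCompact C := isCompact_closedBall _ _
  -- measurability
  have hkm' : AEStronglyMeasurable (fun p : ℝ × ℍ => (k (pointPairInv w p.2) : ℂ)) (μ.prod volume) :=
    (Complex.continuous_ofReal.measurable.comp ((measurable_kernel hkm w).comp measurable_snd)).aestronglyMeasurable
  have hfm : AEStronglyMeasurable (fun p : ℝ × ℍ => f (p.1 +ᵥ p.2)) (μ.prod volume) :=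
    aestronglyMeasurable_comp_vadd hf.aestronglyMeasurable μ
  have hm : AEStronglyMeasurable (fun p : ℝ × ℍ => (k (pointPairInv w p.2) : ℂ) * f (p.1 +ᵥ p.2))
      (μ.prod volume) := hkm'.mul hfm
  rw [integrable_prod_iff hm]
  constructor
  · refine Eventually.of_forall fun ξ => ?_
    exact integrable_kernel_mul ⟨hkm, ⟨B, hB⟩, ⟨M, hM0, hM⟩⟩ (locallyIntegrable_comp_vadd hf ξ) w
  · -- the fibre integrals are bounded by `B ∫_C |f|` for `ξ ∈ (0, 1]`
    have hB0 : 0 ≤ B := (abs_nonneg _).trans (hB 0)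
    have hfC : IntegrableOn f C := hf.integrableOn_isCompact hCc
    refine Integrable.mono' (integrable_const (B * ∫ v in C, ‖f v‖))
      hm.norm.integral_prod_right' ?_
    rw [hμ, ae_restrict_iff' measurableSet_Ioc]
    refine Eventually.of_forall fun ξ hξ => ?_
    rw [Real.norm_of_nonneg (integral_nonneg fun v => norm_nonneg _)]
    -- pointwise bound of the integrand by `B · 𝟙_{B(w,R)}(v) |f(v + ξ)|`
    have hpt : ∀ v : ℍ, ‖(k (pointPairInv w v) : ℂ) * f (ξ +ᵥ v)‖ ≤
        B * (Metric.closedBall w R).indicator (fun v => ‖f (ξ +ᵥ v)‖) v := by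
      intro v
      rw [norm_mul, Complex.norm_real, Real.norm_eq_abs]
      by_cases hv : v ∈ Metric.closedBall w R
      · rw [indicator_of_mem hv]
        exact mul_le_mul_of_nonneg_right (hB _) (norm_nonneg _)
      · have : k (pointPairInv w v) = 0 := by
          by_contra hne
          exact hv (Metric.mem_closedBall.mpr (by rw [dist_comm]; exact kernel_support_radius hM hne))
        rw [this, indicator_of_notMem hv]; simp
    have hmp := measurePreserving_vadd ξ
    have hme : MeasurableEmbedding fun z : ℍ => ξ +ᵥ z :=
      (isometry_real_vadd ξ).isClosedEmbedding.measurableEmbedding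
    -- the translated ball lies in `C`
    have hsub : (fun z : ℍ => ξ +ᵥ z) '' Metric.closedBall w R ⊆ C := by
      rintro _ ⟨v, hv, rfl⟩
      rw [hC, Metric.mem_closedBall]
      calc dist (ξ +ᵥ v) w ≤ dist (ξ +ᵥ v) (ξ +ᵥ w) + dist (ξ +ᵥ w) w := dist_triangle _ _ _
        _ = dist v w + dist (ξ +ᵥ w) w := by rw [(isometry_real_vadd ξ).dist_eq]
        _ ≤ R + 1 / w.im := by
            refine add_le_add (Metric.mem_closedBall.mp hv) ?_
            refine (dist_vadd_self_le ξ w).trans ?_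
            rw [abs_of_pos hξ.1]
            exact div_le_div_of_nonneg_right hξ.2 w.im_pos.le
    have hfi : IntegrableOn (fun v => ‖f (ξ +ᵥ v)‖) (Metric.closedBall w R) := by
      have h1 : IntegrableOn (fun v => ‖f v‖) ((fun z : ℍ => ξ +ᵥ z) '' Metric.closedBall w R) :=
        (hfC.mono_set hsub).norm
      rw [← hmp.integrableOn_comp_preimage hme, hme.injective.preimage_image] at h1
      exact h1
    calc ∫ v, ‖(k (pointPairInv w v) : ℂ) * f (ξ +ᵥ v)‖
        ≤ ∫ v, B * (Metric.closedBall w R).indicator (fun v => ‖f (ξ +ᵥ v)‖) v := by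
          refine integral_mono ?_ ?_ hpt
          · exact (integrable_kernel_mul ⟨hkm, ⟨B, hB⟩, ⟨M, hM0, hM⟩⟩
              (locallyIntegrable_comp_vadd hf ξ) w).norm
          · exact (hfi.integrable_indicator measurableSet_closedBall).const_mul B
      _ = B * ∫ v in Metric.closedBall w R, ‖f (ξ +ᵥ v)‖ := by
          rw [integral_const_mul, integral_indicator measurableSet_closedBall]
      _ = B * ∫ v in (fun z : ℍ => ξ +ᵥ z) '' Metric.closedBall w R, ‖f v‖ := by
          rw [hmp.setIntegral_image_emb hme]
      _ ≤ B * ∫ v in C, ‖f v‖ := by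
          refine mul_le_mul_of_nonneg_left ?_ hB0
          exact setIntegral_mono_set hfC.norm (Eventually.of_forall fun v => norm_nonneg _)
            (Eventually.of_forall hsub)

/-- **`(L_k f)₀ = L_k (f₀)`**: the invariant integral operators commute with the cusp mean
(`L_k` commutes with the horizontal translations, §1.8, and Fubini; this is the computation
`g_𝔞(y) = ∫_ℍ k(z, w) f_𝔞(Im w) dμw` of §4.2). [cite: Iwaniec2002, §4.2, PDF p. 49] -/
theorem cuspMean_invariantOperator (hk : IsTestKernel k) {f : ℍ → ℂ} (hf : LocallyIntegrable f)
    (w : ℍ) :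
    cuspMean (invariantOperator k f) w = invariantOperator k (cuspMean f) w := by
  unfold cuspMean
  simp_rw [invariantOperator_vadd]
  unfold invariantOperator
  rw [intervalIntegral.integral_of_le zero_le_one]
  have hint := integrable_kernel_mul_comp_vadd hk hf w
  rw [integral_integral_swap hint]
  refine integral_congr_ae (Eventually.of_forall fun v => ?_)
  simp only
  rw [intervalIntegral.integral_of_le zero_le_one, integral_const_mul]


/-! ## 4. Slices: a.e. statements along horocycles -/

section Slices

/-- If `G₁ = G₂` a.e. on `ℍ`, then for a.e. `w` the horocycle restrictions `ξ ↦ Gᵢ(w + ξ)` agree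
for a.e. `ξ` (Fubini for the measure-preserving skew translation). [folklore] -/
theorem ae_ae_vadd_of_ae {G₁ G₂ : ℍ → ℂ} (h : G₁ =ᵐ[volume] G₂) (μ : Measure ℝ) [SFinite μ] :
    ∀ᵐ w : ℍ, ∀ᵐ ξ : ℝ ∂μ, G₁ (ξ +ᵥ w) = G₂ (ξ +ᵥ w) := by
  -- a measurable null set containing `{G₁ ≠ G₂}`
  set N : Set ℍ := toMeasurable volume {w : ℍ | G₁ w ≠ G₂ w} with hN
  have hN0 : volume N = 0 := by rw [hN, measure_toMeasurable]; exact ae_iff.mp h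
  have hNm : MeasurableSet N := measurableSet_toMeasurable _ _
  -- its preimage under the skew translation is null for `μ ⊗ vol`
  set S : Set (ℝ × ℍ) := (fun p : ℝ × ℍ => (p.1, p.1 +ᵥ p.2)) ⁻¹' (univ ×ˢ N) with hS
  have hS0 : (μ.prod volume) S = 0 := by
    rw [hS, (measurePreserving_skew_vadd μ).measure_preimage (MeasurableSet.univ.prod hNm).nullMeasurableSet,
      Measure.prod_prod, hN0, mul_zero]
  -- swap the factors
  have hS0' : (volume.prod μ) (Prod.swap ⁻¹' S) = 0 := by
    rw [(Measure.measurePreserving_swap (μ := (volume : Measure ℍ)) (ν := μ)).measure_preimage]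
    · exact hS0
    · exact ((MeasurableSet.univ.prod hNm).preimage
        ((measurePreserving_skew_vadd μ).measurable)).nullMeasurableSet
  have h1 : ∀ᵐ p : ℍ × ℝ ∂(volume.prod μ), p ∉ Prod.swap ⁻¹' S := measure_eq_zero_iff_ae_notMem.mp hS0'
  filter_upwards [Measure.ae_ae_of_ae_prod h1] with w hw
  filter_upwards [hw] with ξ hξ
  simp only [hS, mem_preimage, Prod.swap_prod_mk, mem_prod, mem_univ, true_and] at hξ
  by_contra hne
  exact hξ (subset_toMeasurable _ _ hne)

/-- **The cusp mean only depends on the a.e.-class**: `G₁ = G₂` a.e. implies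
`(G₁)₀ = (G₂)₀` a.e. [folklore] -/
theorem cuspMean_congr_ae {G₁ G₂ : ℍ → ℂ} (h : G₁ =ᵐ[volume] G₂) :
    cuspMean G₁ =ᵐ[volume] cuspMean G₂ := by
  filter_upwards [ae_ae_vadd_of_ae h (volume.restrict (Ioc (0 : ℝ) 1))] with w hw
  unfold cuspMean
  rw [intervalIntegral.integral_of_le zero_le_one, intervalIntegral.integral_of_le zero_le_one]
  exact integral_congr_ae hw

variable {k : ℝ → ℝ}

/-- For locally integrable `G` and any `w₀`, `(ξ, v) ↦ G(v + ξ)` is integrable on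
`(0,1] × B(w₀, r)`. [folklore] -/
theorem integrable_comp_vadd_prod_ball {G : ℍ → ℂ} (hG : LocallyIntegrable G) (w₀ : ℍ) (r : ℝ) :
    Integrable (fun p : ℝ × ℍ => G (p.1 +ᵥ p.2))
      ((volume.restrict (Ioc (0 : ℝ) 1)).prod (volume.restrict (Metric.closedBall w₀ r))) := by
  -- use the ball kernel of radius `δ = sinh²(r/2)`, which is `1` on `B(w₀, r)`
  set δ : ℝ := Real.sinh (max r 0 / 2) ^ 2 with hδ
  have hδ0 : 0 ≤ δ := sq_nonneg _
  have hint := integrable_kernel_mul_comp_vadd (isTestKernel_ballKernel hδ0) hG w₀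
  have hle : (volume.restrict (Ioc (0 : ℝ) 1)).prod (volume.restrict (Metric.closedBall w₀ r)) ≤
      (volume.restrict (Ioc (0 : ℝ) 1)).prod (volume : Measure ℍ) :=
    Measure.prod_mono le_rfl Measure.restrict_le_self
  have h2 := hint.mono_measure hle
  refine h2.congr ?_
  -- on the ball the kernel factor is `1`
  have hmem : ∀ᵐ p : ℝ × ℍ ∂((volume.restrict (Ioc (0 : ℝ) 1)).prod
      (volume.restrict (Metric.closedBall w₀ r))), p.2 ∈ Metric.closedBall w₀ r :=
    (Measure.quasiMeasurePreserving_snd (μ := volume.restrict (Ioc (0 : ℝ) 1))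
      (ν := volume.restrict (Metric.closedBall w₀ r))).ae (ae_restrict_mem measurableSet_closedBall)
  filter_upwards [hmem] with p hp
  have hu : pointPairInv w₀ p.2 ≤ δ := by
    have hd : dist p.2 w₀ ≤ max r 0 := (Metric.mem_closedBall.mp hp).trans (le_max_left _ _)
    rw [pointPairInv_comm]
    exact pointPairInv_le_of_dist_le hd
  rw [ballKernel_of_le hu, Complex.ofReal_one, one_mul]

/-- **Horocycle restrictions of a locally integrable function are locally integrable** for
a.e. base point: `ξ ↦ G(w + ξ)` is integrable on `(0, 1]` for a.e. `w`. [folklore] -/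
theorem ae_intervalIntegrable_comp_vadd {G : ℍ → ℂ} (hG : LocallyIntegrable G) :
    ∀ᵐ w : ℍ, IntervalIntegrable (fun ξ : ℝ => G (ξ +ᵥ w)) volume 0 1 := by
  have hball : ∀ n : ℕ, ∀ᵐ w : ℍ, w ∈ Metric.closedBall UpperHalfPlane.I n →
      IntervalIntegrable (fun ξ : ℝ => G (ξ +ᵥ w)) volume 0 1 := by
    intro n
    have h := (integrable_comp_vadd_prod_ball hG UpperHalfPlane.I n).swap
    have h2 := h.prod_right_ae
    rw [ae_restrict_iff' measurableSet_closedBall] at h2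
    filter_upwards [h2] with w hw hwn
    have h3 := hw hwn
    rw [intervalIntegrable_iff_integrableOn_Ioc_of_le zero_le_one]
    exact h3
  rw [← ae_all_iff] at hball
  filter_upwards [hball] with w hw
  obtain ⟨n, hn⟩ := exists_nat_ge (dist w UpperHalfPlane.I)
  exact hw n (Metric.mem_closedBall.mpr hn)

/-- The cusp mean of a locally integrable function is a.e.-strongly measurable. [folklore] -/
theorem aestronglyMeasurable_cuspMean {G : ℍ → ℂ} (hG : AEStronglyMeasurable G volume) :
    AEStronglyMeasurable (cuspMean G) volume := by
  have h1 : AEStronglyMeasurable (fun p : ℍ × ℝ => G (p.2 +ᵥ p.1))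
      ((volume : Measure ℍ).prod (volume.restrict (Ioc (0 : ℝ) 1))) := by
    have h := (aestronglyMeasurable_comp_vadd hG (volume.restrict (Ioc (0 : ℝ) 1))).prod_swap
    exact h
  have h2 := h1.integral_prod_right'
  have e : (fun w : ℍ => ∫ ξ : ℝ, G (ξ +ᵥ w) ∂(volume.restrict (Ioc (0 : ℝ) 1))) = cuspMean G := by
    funext w
    rw [cuspMean, intervalIntegral.integral_of_le zero_le_one]
  rw [← e]
  exact h2

end Slices

/-! ## 5. The cuspidal subspace of `L²(SL₂(ℤ)\ℍ)` -/

section Cuspidal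

/-- Abbreviations for the standing data of the modular group. -/
local notation "Γℤ" => (𝒮ℒ : Subgroup (GL (Fin 2) ℝ))

/-- `T = (1 1; 0 1) ∈ SL₂(ℤ)` acts by `z ↦ z + 1`, so automorphic functions for the modular group
are `1`-periodic. [cite: Iwaniec2002, (3.1), PDF p. 40] -/
theorem IsAutomorphic.vadd_one {f : ℍ → ℂ} (hf : IsAutomorphic Γℤ f) (z : ℍ) :
    f ((1 : ℝ) +ᵥ z) = f z := by
  rw [← modular_T_smul]
  exact hf _ ⟨ModularGroup.T, rfl⟩ z

/-- The automorphic extension of an automorphic function is the function itself, a.e.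
[cite: Iwaniec2002, §2.2, PDF pp. 28–29] -/
theorem autExt_ae_eq_of_isAutomorphic {Γ : Subgroup (GL (Fin 2) ℝ)} {F : Set ℍ}
    (hΓ : Γ ≤ (Matrix.SpecialLinearGroup.toGL : SL(2, ℝ) →* GL (Fin 2) ℝ).range)
    (hneg : (-1 : GL (Fin 2) ℝ) ∈ Γ) (hd : IsDiscreteSubgroup Γ) (hF : IsHypFundamentalDomain Γ F)
    {f : ℍ → ℂ} (hf : IsAutomorphic Γ f) : autExt Γ F f =ᵐ[volume] f := by
  filter_upwards [ae_autExt_eq_smul hΓ hneg hd hF f] with w hw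
  obtain ⟨γ₀, hγ₀, _, heq, _⟩ := hw
  rw [heq, hf γ₀ hγ₀]

/-- The automorphic extension is additive a.e. [folklore] -/
theorem autExt_add_ae {Γ : Subgroup (GL (Fin 2) ℝ)} {F : Set ℍ}
    (hΓ : Γ ≤ (Matrix.SpecialLinearGroup.toGL : SL(2, ℝ) →* GL (Fin 2) ℝ).range)
    (hneg : (-1 : GL (Fin 2) ℝ) ∈ Γ) (hd : IsDiscreteSubgroup Γ) (hF : IsHypFundamentalDomain Γ F)
    (f g : ℍ → ℂ) :
    autExt Γ F (fun z => f z + g z) =ᵐ[volume] fun z => autExt Γ F f z + autExt Γ F g z := by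
  filter_upwards [ae_orbit_meets_two hΓ hneg hd.countable hF] with w hw
  obtain ⟨γ₀, _, hne, hset⟩ := hw
  rw [autExt_eq_of_orbit _ hne hset, autExt_eq_of_orbit _ hne hset, autExt_eq_of_orbit _ hne hset]

/-- The automorphic extension is homogeneous. [folklore] -/
theorem autExt_const_mul {Γ : Subgroup (GL (Fin 2) ℝ)} {F : Set ℍ} (c : ℂ) (f : ℍ → ℂ) (z : ℍ) :
    autExt Γ F (fun z => c * f z) z = c * autExt Γ F f z := by
  unfold autExt
  have e : ∀ w : ℍ, F.indicator (fun z => c * f z) w = c * F.indicator f w := fun w => by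
    by_cases hw : w ∈ F
    · rw [indicator_of_mem hw, indicator_of_mem hw]
    · rw [indicator_of_notMem hw, indicator_of_notMem hw, mul_zero]
  simp_rw [e]
  rw [tsum_mul_left]
  ring

/-- **The cuspidal subspace** `𝓒 ⊆ L²(F)`, `F = 𝒟` the standard fundamental domain of
`SL₂(ℤ)`: the classes `g` whose automorphic extension `g^Γ` has vanishing cusp mean
`(g^Γ)₀(w) = ∫_0^1 g^Γ(w + ξ) dξ = 0` for a.e. `w` (equivalently for a.e. height `Im w`, the
mean being translation invariant). This is the closure `𝓒̃(Γ\ℍ)` in `L²` of Iwaniec's space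
`𝓒(Γ\ℍ)` of automorphic functions with vanishing zero-th Fourier term (3.15) — the orthogonal
complement of the incomplete Eisenstein series (Lemma 3.3) — realised inside `L²(F)`.
[cite: Iwaniec2002, §3.3 (3.15), PDF p. 44] -/
def cuspSubmodule : Submodule ℂ (Lp ℂ 2 ((volume : Measure ℍ).restrict 𝒟)) where
  carrier := {g | cuspMean (autExt Γℤ 𝒟 g) =ᵐ[volume] 0}
  zero_mem' := by
    simp only [mem_setOf_eq]
    have h0 : autExt Γℤ 𝒟 (⇑(0 : Lp ℂ 2 ((volume : Measure ℍ).restrict 𝒟))) =ᵐ[volume]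
        autExt Γℤ 𝒟 (fun _ => (0 : ℂ)) :=
      autExt_congr_ae modular_le_range_toGL neg_one_mem_modular isDiscreteSubgroup_modular
        isHypFundamentalDomain_modular_fd (Lp.coeFn_zero ℂ 2 _)
    have h1 : autExt Γℤ 𝒟 (fun _ => (0 : ℂ)) = fun _ => 0 := by
      funext z; simp [autExt]
    rw [h1] at h0
    refine (cuspMean_congr_ae h0).trans (Eventually.of_forall fun w => ?_)
    simp [cuspMean]
  add_mem' := by
    intro f g hf hg
    simp only [mem_setOf_eq] at hf hg ⊢
    have hΓ := modular_le_range_toGL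
    have hneg := neg_one_mem_modular
    have hd := isDiscreteSubgroup_modular
    have hF := isHypFundamentalDomain_modular_fd
    have h1 : autExt Γℤ 𝒟 (⇑(f + g)) =ᵐ[volume] autExt Γℤ 𝒟 (fun z => f z + g z) :=
      autExt_congr_ae hΓ hneg hd hF (Lp.coeFn_add f g)
    have h2 := autExt_add_ae hΓ hneg hd hF (⇑f) (⇑g)
    have h3 := cuspMean_congr_ae (h1.trans h2)
    have hfi := ae_intervalIntegrable_comp_vadd (locallyIntegrable_autExt hΓ hneg hd hF (Lp.memLp f))
    have hgi := ae_intervalIntegrable_comp_vadd (locallyIntegrable_autExt hΓ hneg hd hF (Lp.memLp g))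
    filter_upwards [h3, hfi, hgi, hf, hg] with w hw hfw hgw hf0 hg0
    rw [hw, cuspMean_add hfw hgw, hf0, hg0]
    simp
  smul_mem' := by
    intro c g hg
    simp only [mem_setOf_eq] at hg ⊢
    have h1 : autExt Γℤ 𝒟 (⇑(c • g)) =ᵐ[volume] autExt Γℤ 𝒟 (fun z => c * g z) :=
      autExt_congr_ae modular_le_range_toGL neg_one_mem_modular isDiscreteSubgroup_modular
        isHypFundamentalDomain_modular_fd (Lp.coeFn_smul c g)
    have h2 : autExt Γℤ 𝒟 (fun z => c * g z) = fun z => c * autExt Γℤ 𝒟 g z := by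
      funext z; exact autExt_const_mul c g z
    rw [h2] at h1
    filter_upwards [cuspMean_congr_ae h1, hg] with w hw hg0
    rw [hw, cuspMean_const_mul, hg0]
    simp

/-- Membership unfolding. [folklore] -/
theorem mem_cuspSubmodule_iff (g : Lp ℂ 2 ((volume : Measure ℍ).restrict 𝒟)) :
    g ∈ cuspSubmodule ↔ cuspMean (autExt Γℤ 𝒟 g) =ᵐ[volume] 0 := Iff.rfl

end Cuspidal


/-! ## 6. Closedness of the cuspidal subspace -/

section Closed

local notation "Γℤ" => (𝒮ℒ : Subgroup (GL (Fin 2) ℝ))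

/-- A lower bound for the height on a hyperbolic ball: `Im w ≥ Im z₀ · e^{-D}` on `B(z₀, D)`. [folklore] -/
theorem im_ge_of_mem_closedBall {z₀ w : ℍ} {D : ℝ} (hw : w ∈ Metric.closedBall z₀ D) :
    z₀.im * Real.exp (-D) ≤ w.im := by
  have h := im_div_exp_dist_le z₀ w
  have hd : dist z₀ w ≤ D := by rw [dist_comm]; exact Metric.mem_closedBall.mp hw
  calc z₀.im * Real.exp (-D) ≤ z₀.im * Real.exp (-dist z₀ w) := by
        gcongr
    _ = z₀.im / Real.exp (dist z₀ w) := by rw [Real.exp_neg, div_eq_mul_inv]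
    _ ≤ w.im := h

/-- Translates by `ξ ∈ (0, 1]` of `B(z₀, D)` stay in `B(z₀, D + e^D / Im z₀)`. [folklore] -/
theorem vadd_mem_closedBall {z₀ w : ℍ} {D ξ : ℝ} (hw : w ∈ Metric.closedBall z₀ D) (hξ : ξ ∈ Ioc (0 : ℝ) 1) :
    ξ +ᵥ w ∈ Metric.closedBall z₀ (D + Real.exp D / z₀.im) := by
  rw [Metric.mem_closedBall]
  have hD : 0 ≤ D := dist_nonneg.trans (Metric.mem_closedBall.mp hw)
  have him := im_ge_of_mem_closedBall hw
  have hpos : 0 < z₀.im * Real.exp (-D) := mul_pos z₀.im_pos (Real.exp_pos _)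
  calc dist (ξ +ᵥ w) z₀ ≤ dist (ξ +ᵥ w) w + dist w z₀ := dist_triangle _ _ _
    _ ≤ |ξ| / w.im + D := add_le_add (dist_vadd_self_le ξ w) (Metric.mem_closedBall.mp hw)
    _ ≤ 1 / (z₀.im * Real.exp (-D)) + D := by
        gcongr
        · rw [abs_of_pos hξ.1]; exact hξ.2
    _ = D + Real.exp D / z₀.im := by
        rw [Real.exp_neg]; field_simp; ring

/-- **The `L¹` mass of the cusp mean on a ball is controlled by the `L¹` mass of the function on a
bigger ball**: `∫_{B(z₀,D)} |G₀| dμ ≤ ∫_{B(z₀, D + e^D/Im z₀)} |G| dμ` (Tonelli and invariance of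
`μ` under horizontal translations). [folklore] -/
theorem lintegral_enorm_cuspMean_le {G : ℍ → ℂ} (hG : AEStronglyMeasurable G volume) (z₀ : ℍ) (D : ℝ) :
    ∫⁻ w in Metric.closedBall z₀ D, ‖cuspMean G w‖ₑ ≤
      ∫⁻ w in Metric.closedBall z₀ (D + Real.exp D / z₀.im), ‖G w‖ₑ := by
  set C : Set ℍ := Metric.closedBall z₀ D with hC
  set C' : Set ℍ := Metric.closedBall z₀ (D + Real.exp D / z₀.im) with hC'
  set μ : Measure ℝ := volume.restrict (Ioc (0 : ℝ) 1) with hμ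
  have hm : AEMeasurable (Function.uncurry fun (w : ℍ) (ξ : ℝ) => ‖G (ξ +ᵥ w)‖ₑ)
      ((volume.restrict C).prod μ) := by
    have h := ((aestronglyMeasurable_comp_vadd hG μ).prod_swap).aemeasurable.enorm
    exact h.mono_measure (Measure.prod_mono Measure.restrict_le_self le_rfl)
  calc ∫⁻ w in C, ‖cuspMean G w‖ₑ
      ≤ ∫⁻ w in C, (∫⁻ ξ, ‖G (ξ +ᵥ w)‖ₑ ∂μ) := by
        refine lintegral_mono fun w => ?_
        rw [cuspMean, intervalIntegral.integral_of_le zero_le_one]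
        exact enorm_integral_le_lintegral_enorm _
    _ = ∫⁻ ξ, (∫⁻ w in C, ‖G (ξ +ᵥ w)‖ₑ) ∂μ := lintegral_lintegral_swap hm
    _ ≤ ∫⁻ ξ, (∫⁻ w in C', ‖G w‖ₑ) ∂μ := by
        refine lintegral_mono_ae ?_
        rw [hμ, ae_restrict_iff' measurableSet_Ioc]
        refine Eventually.of_forall fun ξ hξ => ?_
        have hme : MeasurableEmbedding fun z : ℍ => ξ +ᵥ z :=
          (isometry_real_vadd ξ).isClosedEmbedding.measurableEmbedding
        calc ∫⁻ w in C, ‖G (ξ +ᵥ w)‖ₑ = ∫⁻ w, C.indicator (fun w => ‖G (ξ +ᵥ w)‖ₑ) w :=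
              (lintegral_indicator measurableSet_closedBall _).symm
          _ ≤ ∫⁻ w, C'.indicator (fun v => ‖G v‖ₑ) (ξ +ᵥ w) := by
              refine lintegral_mono fun w => ?_
              by_cases hw : w ∈ C
              · rw [indicator_of_mem hw, indicator_of_mem (vadd_mem_closedBall hw hξ)]
              · rw [indicator_of_notMem hw]; exact zero_le
          _ = ∫⁻ v, C'.indicator (fun v => ‖G v‖ₑ) v :=
              (measurePreserving_vadd ξ).lintegral_comp_emb hme _
          _ = ∫⁻ v in C', ‖G v‖ₑ := lintegral_indicator measurableSet_closedBall _
    _ = (∫⁻ w in C', ‖G w‖ₑ) * μ univ := by rw [lintegral_const]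
    _ = ∫⁻ w in C', ‖G w‖ₑ := by
        rw [hμ, Measure.restrict_apply_univ, Real.volume_Ioc]; simp

/-- `L¹` on a set of finite measure is controlled by `L²` (Cauchy–Schwarz):
`∫_S |G| ≤ μ(S)^{1/2} (∫_S |G|²)^{1/2}`. [folklore] -/
theorem lintegral_enorm_le_sqrt_mul {S : Set ℍ} {G : ℍ → ℂ} (hG : AEStronglyMeasurable G volume) :
    ∫⁻ w in S, ‖G w‖ₑ ≤ (volume S) ^ (1 / 2 : ℝ) * (∫⁻ w in S, ‖G w‖ₑ ^ 2) ^ (1 / 2 : ℝ) := by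
  have h := ENNReal.lintegral_mul_le_Lp_mul_Lq (volume.restrict S) Real.HolderConjugate.two_two
    (f := fun _ => (1 : ℝ≥0∞)) (g := fun w => ‖G w‖ₑ) aemeasurable_const hG.restrict.aemeasurable.enorm
  simp only [Pi.mul_apply, one_mul, ENNReal.one_rpow, lintegral_const, Measure.restrict_apply_univ] at h
  have e : ∀ w : ℍ, ‖G w‖ₑ ^ (2 : ℝ) = ‖G w‖ₑ ^ (2 : ℕ) := fun w => by
    rw [← ENNReal.rpow_natCast]; norm_num
  simp_rw [e] at h
  exact h

/-- **Continuity estimate for the cusp-mean map `g ↦ (g^Γ)₀`** from `L²(𝒟)` to `L¹_loc(ℍ)`: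
`∫_{B(z₀,D)} |(g^Γ)₀| dμ ≤ K · (∫_𝒟 |g|²)^{1/2}` with `K` depending only on the ball. [folklore] -/
theorem lintegral_enorm_cuspMean_autExt_le (z₀ : ℍ) (D : ℝ) :
    ∃ K : ℝ≥0∞, K ≠ ∞ ∧ ∀ g : ℍ → ℂ, AEStronglyMeasurable g (volume.restrict 𝒟) →
      ∫⁻ w in Metric.closedBall z₀ D, ‖cuspMean (autExt Γℤ 𝒟 g) w‖ₑ ≤
        K * (∫⁻ w in 𝒟, ‖g w‖ₑ ^ 2) ^ (1 / 2 : ℝ) := by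
  have hΓ := modular_le_range_toGL
  have hneg := neg_one_mem_modular
  have hd := isDiscreteSubgroup_modular
  have hF := isHypFundamentalDomain_modular_fd
  set D' : ℝ := D + Real.exp D / z₀.im with hD'
  set C' : Set ℍ := Metric.closedBall z₀ D' with hC'
  set N : ℝ≥0∞ := ∑' δ : Γℤ, {δ : Γℤ | dist ((δ : GL (Fin 2) ℝ) • z₀) z₀ ≤ 2 * D'}.indicator
    (fun _ => (1 : ℝ≥0∞)) δ with hN
  have hNfin : N ≠ ∞ := (tsum_indicator_dist_le_lt_top hΓ hd z₀ (2 * D')).ne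
  refine ⟨(volume C') ^ (1 / 2 : ℝ) * N ^ (1 / 2 : ℝ), ?_, fun g hg => ?_⟩
  · exact ENNReal.mul_ne_top (ENNReal.rpow_ne_top_of_nonneg (by norm_num)
      (isCompact_closedBall _ _).measure_lt_top.ne) (ENNReal.rpow_ne_top_of_nonneg (by norm_num) hNfin)
  have hGm : AEStronglyMeasurable (autExt Γℤ 𝒟 g) volume := aestronglyMeasurable_autExt hΓ hneg hd hF hg
  have h1 := lintegral_enorm_cuspMean_le hGm z₀ D
  have h2 := lintegral_enorm_le_sqrt_mul (S := C') hGm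
  have h3 := lintegral_enorm_sq_autExt_le hΓ hneg hd hF measurableSet_closedBall (subset_refl C') hg
  -- `∫_{C'} |g^Γ|² ≤ 2 ∫_{C'} |g^Γ|² ≤ N ∫_𝒟 |g|²`
  have h4 : ∫⁻ w in C', ‖autExt Γℤ 𝒟 g w‖ₑ ^ 2 ≤ N * ∫⁻ w in 𝒟, ‖g w‖ₑ ^ 2 := by
    refine le_trans ?_ h3
    conv_lhs => rw [← one_mul (∫⁻ w in C', ‖autExt Γℤ 𝒟 g w‖ₑ ^ 2)]
    gcongr
    norm_num
  calc ∫⁻ w in Metric.closedBall z₀ D, ‖cuspMean (autExt Γℤ 𝒟 g) w‖ₑ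
      ≤ ∫⁻ w in C', ‖autExt Γℤ 𝒟 g w‖ₑ := h1
    _ ≤ (volume C') ^ (1 / 2 : ℝ) * (∫⁻ w in C', ‖autExt Γℤ 𝒟 g w‖ₑ ^ 2) ^ (1 / 2 : ℝ) := h2
    _ ≤ (volume C') ^ (1 / 2 : ℝ) * (N * ∫⁻ w in 𝒟, ‖g w‖ₑ ^ 2) ^ (1 / 2 : ℝ) := by
        gcongr
    _ = (volume C') ^ (1 / 2 : ℝ) * N ^ (1 / 2 : ℝ) * (∫⁻ w in 𝒟, ‖g w‖ₑ ^ 2) ^ (1 / 2 : ℝ) := by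
        rw [ENNReal.mul_rpow_of_nonneg _ _ (by norm_num), mul_assoc]

/-- The `L²(𝒟)` norm as a Lebesgue integral: `(∫_𝒟 |g|²)^{1/2} = ‖g‖`. [folklore] -/
theorem lintegral_rpow_eq_enorm (g : Lp ℂ 2 ((volume : Measure ℍ).restrict 𝒟)) :
    (∫⁻ w in 𝒟, ‖g w‖ₑ ^ 2) ^ (1 / 2 : ℝ) = ‖g‖ₑ := by
  rw [Lp.enorm_def, eLpNorm_eq_lintegral_rpow_enorm_toReal (by norm_num) ENNReal.ofNat_ne_top]
  simp only [ENNReal.toReal_ofNat, one_div]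
  congr 1
  refine lintegral_congr fun w => ?_
  rw [← ENNReal.rpow_natCast]; norm_num

/-- **The cuspidal subspace is closed in `L²(𝒟)`** (the cusp-mean map is continuous into
`L¹_loc`; Iwaniec works with the closure `𝓒̃(Γ\ℍ)` directly, §3.3). [cite: Iwaniec2002, §3.3, PDF p. 44] -/
theorem isClosed_cuspSubmodule :
    IsClosed (cuspSubmodule : Set (Lp ℂ 2 ((volume : Measure ℍ).restrict 𝒟))) := by
  have hΓ := modular_le_range_toGL
  have hneg := neg_one_mem_modular
  have hd := isDiscreteSubgroup_modular
  have hF := isHypFundamentalDomain_modular_fd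
  refine IsSeqClosed.isClosed fun u g hu hug => ?_
  rw [SetLike.mem_coe, mem_cuspSubmodule_iff]
  -- it suffices to prove vanishing a.e. on every ball `B(i, n)`
  suffices h : ∀ n : ℕ, ∀ᵐ w : ℍ, w ∈ Metric.closedBall UpperHalfPlane.I n →
      cuspMean (autExt Γℤ 𝒟 g) w = 0 by
    rw [← ae_all_iff] at h
    filter_upwards [h] with w hw
    obtain ⟨n, hn⟩ := exists_nat_ge (dist w UpperHalfPlane.I)
    exact hw n (Metric.mem_closedBall.mpr hn)
  intro n
  obtain ⟨K, hK, hest⟩ := lintegral_enorm_cuspMean_autExt_le UpperHalfPlane.I n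
  set Φ : ℍ → ℂ := cuspMean (autExt Γℤ 𝒟 g) with hΦ
  have hΦm : AEStronglyMeasurable Φ volume :=
    aestronglyMeasurable_cuspMean (aestronglyMeasurable_autExt hΓ hneg hd hF (Lp.memLp g).1)
  -- the `L¹` mass of `Φ` on the ball is bounded by `K ‖g - u m‖` for every `m`
  have hbound : ∀ m : ℕ, ∫⁻ w in Metric.closedBall UpperHalfPlane.I n, ‖Φ w‖ₑ ≤ K * ‖g - u m‖ₑ := by
    intro m
    have hum : cuspMean (autExt Γℤ 𝒟 (u m)) =ᵐ[volume] 0 := hu m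
    -- `g^Γ = (g - u m)^Γ + (u m)^Γ` a.e., hence the same for cusp means a.e.
    have h1 : autExt Γℤ 𝒟 (⇑g) =ᵐ[volume] autExt Γℤ 𝒟 (fun z => (g - u m) z + (u m) z) := by
      refine autExt_congr_ae hΓ hneg hd hF ?_
      filter_upwards [Lp.coeFn_sub g (u m)] with z hz
      rw [hz]; simp
    have h2 := autExt_add_ae hΓ hneg hd hF (⇑(g - u m)) (⇑(u m))
    have h3 := cuspMean_congr_ae (h1.trans h2)
    have hfi := ae_intervalIntegrable_comp_vadd (locallyIntegrable_autExt hΓ hneg hd hF (Lp.memLp (g - u m)))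
    have hgi := ae_intervalIntegrable_comp_vadd (locallyIntegrable_autExt hΓ hneg hd hF (Lp.memLp (u m)))
    have h4 : Φ =ᵐ[volume] cuspMean (autExt Γℤ 𝒟 (⇑(g - u m))) := by
      filter_upwards [h3, hfi, hgi, hum] with w hw hfw hgw hu0
      rw [hΦ, hw, cuspMean_add hfw hgw, hu0]
      simp
    calc ∫⁻ w in Metric.closedBall UpperHalfPlane.I n, ‖Φ w‖ₑ
        = ∫⁻ w in Metric.closedBall UpperHalfPlane.I n, ‖cuspMean (autExt Γℤ 𝒟 (⇑(g - u m))) w‖ₑ := by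
          refine lintegral_congr_ae ?_
          filter_upwards [ae_restrict_of_ae h4] with w hw
          rw [hw]
      _ ≤ K * (∫⁻ w in 𝒟, ‖(g - u m) w‖ₑ ^ 2) ^ (1 / 2 : ℝ) := hest _ (Lp.memLp (g - u m)).1
      _ = K * ‖g - u m‖ₑ := by rw [lintegral_rpow_eq_enorm]
  -- the right-hand side tends to `0`
  have htend : Tendsto (fun m => K * ‖g - u m‖ₑ) atTop (𝓝 0) := by
    have h1 : Tendsto (fun m => ‖g - u m‖ₑ) atTop (𝓝 0) := by
      have h2 : Tendsto (fun m => g - u m) atTop (𝓝 0) := by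
        have := (tendsto_const_nhds (x := g)).sub hug
        rwa [sub_self] at this
      have h3 := (continuous_enorm.tendsto (0 : Lp ℂ 2 ((volume : Measure ℍ).restrict 𝒟))).comp h2
      rw [enorm_zero] at h3
      exact h3
    have h4 := ENNReal.Tendsto.const_mul h1 (Or.inr hK)
    rwa [mul_zero] at h4
  have hzero : ∫⁻ w in Metric.closedBall UpperHalfPlane.I n, ‖Φ w‖ₑ = 0 :=
    le_antisymm (ge_of_tendsto' htend hbound) bot_le
  rw [lintegral_eq_zero_iff' hΦm.restrict.aemeasurable.enorm] at hzero
  rw [← ae_restrict_iff' measurableSet_closedBall]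
  filter_upwards [hzero] with w hw
  simpa using hw

end Closed

/-! ## 7. Invariance under the invariant integral operators -/

section Invariance

local notation "Γℤ" => (𝒮ℒ : Subgroup (GL (Fin 2) ℝ))

variable {k : ℝ → ℝ}

/-- `T_k g` (as the function `z ↦ ½ ∫_F K(z,w) g(w) dμ(w)` on `ℍ`) is automorphic. [folklore] -/
theorem isAutomorphic_kernelOp {Γ : Subgroup (GL (Fin 2) ℝ)} {F : Set ℍ}
    (hΓ : Γ ≤ (Matrix.SpecialLinearGroup.toGL : SL(2, ℝ) →* GL (Fin 2) ℝ).range)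
    (hd : IsDiscreteSubgroup Γ) (hk : IsTestKernel k) (g : ℍ → ℂ) :
    IsAutomorphic Γ (kernelOp Γ F k g) := by
  obtain ⟨_, _, ⟨M, _, hM⟩⟩ := hk
  intro γ hγ z
  rw [kernelOp_apply, kernelOp_apply]
  congr 1
  refine integral_congr_ae (Eventually.of_forall fun w => ?_)
  simp only
  rw [automorphicKernel_smul_left hΓ hd hM hγ]

/-- `L_k` kills a.e.-vanishing functions. [folklore] -/
theorem invariantOperator_of_ae_eq_zero {f : ℍ → ℂ} (hf : f =ᵐ[volume] 0) (z : ℍ) :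
    invariantOperator k f z = 0 := by
  rw [invariantOperator_apply]
  have : (fun w : ℍ => (k (pointPairInv z w) : ℂ) * f w) =ᵐ[volume] fun _ => 0 := by
    filter_upwards [hf] with w hw
    rw [hw]; simp
  rw [integral_congr_ae this, integral_zero]

/-- **The cuspidal subspace is invariant under `T_k`**: for `g ∈ 𝓒`,
`(T_k g)^Γ = L_k g^Γ` a.e. and `(L_k g^Γ)₀ = L_k((g^Γ)₀) = L_k 0 = 0` (Iwaniec §4.2, Proposition:
"an invariant integral operator `L` maps the subspace `𝓒(Γ\ℍ)` into itself").
[cite: Iwaniec2002, §4.2, PDF p. 49] -/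
theorem kernelCLM_mem_cuspSubmodule (hk : IsTestKernel k) (hkc : Continuous k)
    {g : Lp ℂ 2 ((volume : Measure ℍ).restrict 𝒟)} (hg : g ∈ cuspSubmodule) :
    kernelCLM modular_le_range_toGL neg_one_mem_modular isDiscreteSubgroup_modular
      isHypFundamentalDomain_modular_fd hk hkc g ∈ cuspSubmodule := by
  have hΓ := modular_le_range_toGL
  have hneg := neg_one_mem_modular
  have hd := isDiscreteSubgroup_modular
  have hF := isHypFundamentalDomain_modular_fd
  rw [mem_cuspSubmodule_iff] at hg ⊢
  set G : ℍ → ℂ := autExt Γℤ 𝒟 g with hG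
  have hGl : LocallyIntegrable G := locallyIntegrable_autExt hΓ hneg hd hF (Lp.memLp g)
  -- `(T_k g)^Γ = L_k G` a.e.
  have h1 : autExt Γℤ 𝒟 (⇑(kernelCLM hΓ hneg hd hF hk hkc g)) =ᵐ[volume]
      autExt Γℤ 𝒟 (kernelOp Γℤ 𝒟 k g) :=
    autExt_congr_ae hΓ hneg hd hF (kernelCLM_coeFn hΓ hneg hd hF hk hkc g)
  have h2 : autExt Γℤ 𝒟 (kernelOp Γℤ 𝒟 k g) =ᵐ[volume] kernelOp Γℤ 𝒟 k g :=
    autExt_ae_eq_of_isAutomorphic hΓ hneg hd hF (isAutomorphic_kernelOp hΓ hd hk _)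
  have h3 : (kernelOp Γℤ 𝒟 k g : ℍ → ℂ) =ᵐ[volume] invariantOperator k G :=
    Eventually.of_forall fun z => kernelOp_eq_invariantOperator hΓ hneg hd hF hk (Lp.memLp g) z
  refine (cuspMean_congr_ae ((h1.trans h2).trans h3)).trans (Eventually.of_forall fun w => ?_)
  rw [cuspMean_invariantOperator hk hGl w]
  exact invariantOperator_of_ae_eq_zero hg w

end Invariance

end Literature.NumberTheory.Automorphic
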